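import Literature.AlgebraicGeometry.Frobenioids.ArchimedeanFSMMonoCondBA
import Literature.AlgebraicGeometry.Frobenioids.ArchimedeanRealObjectsIso
import HarnessLib

/-!
# Frobenioids II, Proposition 3.4 (ii) under condition (b), for the non-rigidified angloid `N`: PROOF
# (abc-iut cell, layer L1, node `FrdII:Prop3.4(ii)`, sub-nodes P34-L02/L03, chain LC-L1-2)

Mochizuki, *The geometry of Frobenioids II: poly-Frobenioids*, Kyushu J. Math. **62** (2008)
401–460, §3, Proposition 3.4 (ii) p. 30, proof pp. 30–31 [cite: MochizukiFrdII2008, Prop 3.4 (ii) p.30].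
PROOF-ONLY companion of `ArchimedeanFSM.lean` (statements, abc-iut-L1-t6); nothing is defined here.

The tower `N` (`F = N = A^lin`, words read through `C = C₀ ×_{D₀} D`; `F₀ = N₀`): the argument of
`ArchimedeanFSMMonoCondBA.lean` (tower `A`) verbatim, with the extra bookkeeping that all arrows of `N`
are LINEAR and that isometries / isotropic hulls are read through `C`'s pre-Frobenioid structure:
(Step 1) co-angularity of the Frobenius-type factor of condition (b), tested inside `N`, gives
`twist(B_{X′}) ⊆ (c_β/|c_β|) · B_X`; (Step 2) the inclusion of `X′` into the object with full angular
part is an isotropic hull IN `N` (isotropic objects of `N` = objects with full angular part, proved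
here in passing); condition (b) then leaves at most one direction out of `B_{X′}`; (Step 3/4) the
conjugate linear isometries of `ArchimedeanLargeArcs.lean` lift over `α_D, β_D` to `N` and `φ` mono gives
`α_D = β_D`. Result: `N.propII : (towerN π).PropII` (item (ii) for `F = N`, both conditions, AS TYPED).
No statement of the paper is strengthened; no side is taken on [IUTchIII] Cor. 3.12.
-/

namespace Literature.AlgebraicGeometry.Frobenioids

open CategoryTheory Set
open scoped Pointwise

noncomputable section

namespace ArchFrd

universe v u

variable {D : Type u} [Category.{v} D] (π : D ⥤ D0)

/-! ### The full-angular-part object over an object of `N` -/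

/-- For `X′ ∈ Ob(N)`: the object `X″` of `N` with the same base, `D`-component and tip and FULL angular
part, with the linear isometry `h = ((𝟙, 1, 1), 𝟙) : X′ → X″`, an isometric pre-step of `N`;
if `h` is invertible then `X′` already has full angular part.
[cite: MochizukiFrdII2008, Prop 3.4 (ii) p.30] -/
theorem N.exists_full_inclusion (X' : N π) :
    ∃ (X'' : N π) (h : X' ⟶ X''), X''.obj.obj.fst.IsNaivelyIsotropic ∧
      X''.obj.obj.fst.base = X'.obj.obj.fst.base ∧ X''.obj.obj.fst.tip = X'.obj.obj.fst.tip ∧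
      X''.obj.obj.snd = X'.obj.obj.snd ∧
      PreFrobenioid.IsIsometry (N.toC π ⋙ C.toElem π) h ∧
      PreFrobenioid.IsPreStep (N.toC π ⋙ C.toElem π) h ∧
      (IsIso h → X'.obj.obj.fst.IsNaivelyIsotropic) := by
  obtain ⟨⟨⟨X'₀, X'D, ιX'⟩⟩⟩ := X'
  let F₀ : C0 := ⟨X'₀.base, AngularRegion.isotropicOfTip X'₀.region.tip,
    fun _ => AngularRegion.isIsotropic_isotropicOfTip _⟩
  have hF₀ : F₀.IsNaivelyIsotropic := AngularRegion.isIsotropic_isotropicOfTip _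
  have hmh : (1 : ℂˣ) • X'₀.region.carrier ^ ((1 : ℕ+) : ℕ) ⊆ C0.pullRegion F₀ (𝟙 X'₀.base) := by
    rw [one_smul, PNat.one_coe, pow_one, show (𝟙 X'₀.base) = 𝟙 F₀.base from rfl, C0.pullRegion_id]
    intro u hu
    rw [C0.mem_carrier_of_isIsotropic hF₀]
    exact ((X'₀.region.mem_carrier_polar_iff u).mp hu).2
  let h₀ : X'₀ ⟶ F₀ := ⟨𝟙 _, 1, 1, one_mem _, hmh⟩
  let FC : C π := ⟨F₀, X'D, ιX'⟩
  have wh : (PreFrobenioid.baseFunctor C0.toElem).map h₀ ≫ FC.iso.hom = ιX'.hom ≫ π.map (𝟙 X'D) := by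
    change 𝟙 _ ≫ ιX'.hom = ιX'.hom ≫ π.map (𝟙 X'D)
    rw [CategoryTheory.Functor.map_id, Category.id_comp, Category.comp_id]
  let hC : (⟨X'₀, X'D, ιX'⟩ : C π) ⟶ FC := ⟨h₀, 𝟙 X'D, wh⟩
  have hh₀ : PreFrobenioid.IsIsometry C0.toElem h₀ := by
    rw [A0.isIsometry_iff_norm_mul_tip_pow]
    change ‖((1 : ℂˣ) : ℂ)‖ * X'₀.tip ^ ((1 : ℕ+) : ℕ) = X'₀.tip
    rw [Units.val_one, norm_one, one_mul, PNat.one_coe, pow_one]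
  have hhA : PreFrobenioid.isometricMorphisms (C.toElem π) hC := by
    change pull _ _ (PreFrobenioid.Div C0.toElem h₀) = 1
    rw [show PreFrobenioid.Div C0.toElem h₀ = 1 from hh₀, map_one]
  let hA : (⟨⟨X'₀, X'D, ιX'⟩⟩ : A π) ⟶ ⟨FC⟩ := ⟨hC, hhA⟩
  have hlin : PreFrobenioid.linearMorphisms (A.toElem π) hA := by
    change C0.degFr h₀ = 1; rfl
  let hN : (⟨⟨⟨X'₀, X'D, ιX'⟩⟩⟩ : N π) ⟶ ⟨⟨FC⟩⟩ := ⟨hA, hlin⟩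
  refine ⟨⟨⟨FC⟩⟩, hN, hF₀, rfl, rfl, rfl, hhA, ⟨rfl, ?_⟩, fun hiso => ?_⟩
  · change IsIso (𝟙 X'D); infer_instance
  · haveI : IsIso hN.hom.hom := by
      haveI := hiso
      exact (inferInstance : IsIso ((N.toC π).map hN))
    haveI : IsIso h₀ := CFP.isIso_fst hN.hom.hom
    change X'₀.region.dir = univ
    refine eq_univ_of_forall fun w => ?_
    have hmem : ((w : ↥(normOneSubgroup ℂ)) : ℂˣ) * ofPosReal ℂ X'₀.region.tip ∈ F₀.region.carrier := by
      rw [C0.mem_carrier_of_isIsotropic hF₀, map_mul, absHom_coe_normOne, one_mul, absHom_ofPosReal]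
      exact le_rfl
    have h := C0.act_mem_carrier_of_isIso h₀ rfl rfl hmem
    change D0.galAct (D0.Hom.twists (𝟙 X'₀.base)) _ ∈ _ at h
    rw [D0.twists_id, D0.galAct_false, AngularRegion.coe_mul_ofPosReal_mem_carrier_iff] at h
    exact h.1

/-- The isotropic objects of `N` (for the words read through `C`) are the objects with full angular
part. [cite: MochizukiFrdII2008, Ex 3.3 (iii) p.29] -/
theorem N.isNaivelyIsotropic_of_isIsotropic (W : N π)
    (hW : PreFrobenioid.IsIsotropic (N.toC π ⋙ C.toElem π) W) : W.obj.obj.fst.IsNaivelyIsotropic := by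
  obtain ⟨W'', h, -, -, -, -, hiso, hpre, hfull⟩ := N.exists_full_inclusion π W
  exact hfull (hW h hiso hpre)

/-- An object of `N` with full angular part is isotropic (every isometric pre-step out of it is an
isomorphism: linear isometric base-isomorphisms out of a naively isotropic object of `C₀` are
invertible). [cite: MochizukiFrdII2008, Ex 3.3 (iii) p.29] -/
theorem N.isIsotropic_of_isNaivelyIsotropic (W : N π) (hW : W.obj.obj.fst.IsNaivelyIsotropic) :
    PreFrobenioid.IsIsotropic (N.toC π ⋙ C.toElem π) W := by
  intro V ψ hiso hpre
  have hbi : IsIso ψ.hom.hom.snd := hpre.2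
  haveI : IsIso (C0.Base ψ.hom.hom.fst) := A.isIso_base0_of_isIso_toD π ψ.hom hbi
  have hψ₀ : PreFrobenioid.IsIsometry C0.toElem ψ.hom.hom.fst := ψ.hom.property
  haveI : IsIso ψ.hom.hom.fst := C0.isIso_of_isIsotropic ψ.hom.hom.fst hW ψ.property
    ((A0.isIsometry_iff_norm_mul_tip_pow _).mp hψ₀)
  haveI : IsIso ψ.hom.hom.snd := hbi
  haveI : IsIso ψ.hom.hom := CFP.isIso_of_isIso_fst_snd ψ.hom.hom
  exact N.isIso_of_isIso_hom ψ

/-! ### Step 1 for `N`: co-angularity of the Frobenius-type factor -/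

/-- **Step 1 for `N`**: for a morphism of Frobenius type `β : X → X′` of `N` (words read through `C`),
the region of `X′` pulled back along `Base(β₀)` has angular part INSIDE `(c_β/|c_β|) · B_X^{·deg β₀}`.
[cite: MochizukiFrdII2008, Prop 3.4 (ii) p.30] -/
theorem N.act_mem_product_of_isFrobeniusType {X X' : N π} (β : X ⟶ X')
    (hβ : PreFrobenioid.IsFrobeniusType (N.toC π ⋙ C.toElem π) β) :
    ∀ y ∈ X'.obj.obj.fst.region.carrier,
      unitPart ℂ ((C0.Base β.hom.hom.fst).act y) ∈
        unitPart ℂ (C0.scalar β.hom.hom.fst) • X.obj.obj.fst.region.dir ^ (C0.degFr β.hom.hom.fst : ℕ) := by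
  obtain ⟨⟨⟨X₀, XD, ιX⟩⟩⟩ := X
  obtain ⟨⟨⟨X'₀, X'D, ιX'⟩⟩⟩ := X'
  obtain ⟨⟨⟨β₀, βD, wβ⟩, hβiso⟩, hβlin⟩ := β
  obtain ⟨⟨hco, -⟩, hbi⟩ := hβ
  haveI : IsIso βD := hbi
  obtain ⟨Q, hQ, γ₀, ι₀, hQd, hQt, hfac, hγb, hιb, hιd, hιs, hιiso, -⟩ := C0.exists_factor_product β₀
  let X₃ : C π := ⟨C0.mk X₀.base Q hQ, XD, ιX⟩
  have wγ : (PreFrobenioid.baseFunctor C0.toElem).map γ₀ ≫ X₃.iso.hom = ιX.hom ≫ π.map (𝟙 XD) := by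
    change C0.Base γ₀ ≫ ιX.hom = ιX.hom ≫ π.map (𝟙 XD)
    rw [hγb, CategoryTheory.Functor.map_id, Category.id_comp, Category.comp_id]
  have wι : (PreFrobenioid.baseFunctor C0.toElem).map ι₀ ≫ ιX'.hom = X₃.iso.hom ≫ π.map βD := by
    change C0.Base ι₀ ≫ ιX'.hom = ιX.hom ≫ π.map βD
    rw [hιb]; exact wβ
  let γC : (⟨X₀, XD, ιX⟩ : C π) ⟶ X₃ := ⟨γ₀, 𝟙 XD, wγ⟩
  let ιC : X₃ ⟶ (⟨X'₀, X'D, ιX'⟩ : C π) := ⟨ι₀, βD, wι⟩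
  have hι₀ : PreFrobenioid.Div C0.toElem ι₀ = 1 := hιiso
  have hιA : PreFrobenioid.isometricMorphisms (C.toElem π) ιC := by
    change pull _ _ (PreFrobenioid.Div C0.toElem ι₀) = 1
    rw [hι₀, map_one]
  have hγA : PreFrobenioid.isometricMorphisms (C.toElem π) γC := by
    have h3 : PreFrobenioid.IsIsometry C0.toElem (γ₀ ≫ ι₀) := by rw [hfac]; exact hβiso
    have h := (C0.isIsometry_of_comp γ₀ ι₀ h3).1
    change pull _ _ (PreFrobenioid.Div C0.toElem γ₀) = 1
    rw [show PreFrobenioid.Div C0.toElem γ₀ = 1 from h, map_one]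
  have hdegγ : C0.degFr γ₀ = 1 := by
    have h := congrArg C0.degFr hfac
    rw [C0.degFr_comp', hιd, mul_one] at h
    exact h.trans hβlin
  let γA : (⟨⟨X₀, XD, ιX⟩⟩ : A π) ⟶ ⟨X₃⟩ := ⟨γC, hγA⟩
  let ιA : (⟨X₃⟩ : A π) ⟶ ⟨⟨X'₀, X'D, ιX'⟩⟩ := ⟨ιC, hιA⟩
  have hγlin : PreFrobenioid.linearMorphisms (A.toElem π) γA := hdegγ
  have hιlin : PreFrobenioid.linearMorphisms (A.toElem π) ιA := hιd
  let γN : (⟨⟨⟨X₀, XD, ιX⟩⟩⟩ : N π) ⟶ ⟨⟨X₃⟩⟩ := ⟨γA, hγlin⟩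
  let ιN : (⟨⟨X₃⟩⟩ : N π) ⟶ ⟨⟨⟨X'₀, X'D, ιX'⟩⟩⟩ := ⟨ιA, hιlin⟩
  have hcomp : γN ≫ ιN ≫ 𝟙 _ = ⟨⟨⟨β₀, βD, wβ⟩, hβiso⟩, hβlin⟩ := by
    rw [Category.comp_id]
    exact WideSubcategory.hom_ext _ (WideSubcategory.hom_ext _ (CFP.hom_ext hfac (Category.id_comp _)))
  have hιIso : IsIso ιN := by
    refine hco γN ιN (𝟙 _) hcomp rfl hιA ⟨hιd, ?_⟩ (Or.inr ?_)
    · change IsIso βD; infer_instance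
    · change IsIso (𝟙 XD); infer_instance
  haveI : IsIso ιN.hom.hom := by
    haveI := hιIso
    exact (inferInstance : IsIso ((N.toC π).map ιN))
  haveI : IsIso ι₀ := CFP.isIso_fst ιN.hom.hom
  intro y hy
  have hmem := C0.act_mem_carrier_of_isIso ι₀ hιd hιs hy
  rw [hιb] at hmem
  have h := ((C0.mk X₀.base Q hQ).region.mem_carrier_polar_iff _).mp hmem
  rw [← hQd]
  exact h.1

/-! ### Step 2 for `N`: the isotropic hull -/

/-- **Step 2 for `N`**: the inclusion of `X′ ∈ Ob(N)` into the object with full angular part is an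
isotropic hull IN `N`; hence condition (b)'s clause leaves at most one direction out of `B_{X′}`.
[cite: MochizukiFrdII2008, Prop 3.4 (ii) p.30] -/
theorem N.compl_subset_dir_of_hulls (X' : N π)
    (hh : ∀ (X'' : N π) (h : X' ⟶ X''), PreFrobenioid.IsIsotropicHull (N.toC π ⋙ C.toElem π) h →
      IsIso h ∨ (towerN π).IsSlit h) :
    ∃ z : ↥(normOneSubgroup ℂ), ({z}ᶜ : Set ↥(normOneSubgroup ℂ)) ⊆ X'.obj.obj.fst.region.dir := by
  obtain ⟨⟨⟨X'₀, X'D, ιX'⟩⟩⟩ := X'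
  -- the full object and the inclusion, as in `N.exists_full_inclusion`
  let F₀ : C0 := ⟨X'₀.base, AngularRegion.isotropicOfTip X'₀.region.tip,
    fun _ => AngularRegion.isIsotropic_isotropicOfTip _⟩
  have hF₀ : F₀.IsNaivelyIsotropic := AngularRegion.isIsotropic_isotropicOfTip _
  have hmh : (1 : ℂˣ) • X'₀.region.carrier ^ ((1 : ℕ+) : ℕ) ⊆ C0.pullRegion F₀ (𝟙 X'₀.base) := by
    rw [one_smul, PNat.one_coe, pow_one, show (𝟙 X'₀.base) = 𝟙 F₀.base from rfl, C0.pullRegion_id]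
    intro u hu
    rw [C0.mem_carrier_of_isIsotropic hF₀]
    exact ((X'₀.region.mem_carrier_polar_iff u).mp hu).2
  let h₀ : X'₀ ⟶ F₀ := ⟨𝟙 _, 1, 1, one_mem _, hmh⟩
  let FC : C π := ⟨F₀, X'D, ιX'⟩
  have wh : (PreFrobenioid.baseFunctor C0.toElem).map h₀ ≫ FC.iso.hom = ιX'.hom ≫ π.map (𝟙 X'D) := by
    change 𝟙 _ ≫ ιX'.hom = ιX'.hom ≫ π.map (𝟙 X'D)
    rw [CategoryTheory.Functor.map_id, Category.id_comp, Category.comp_id]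
  let hC : (⟨X'₀, X'D, ιX'⟩ : C π) ⟶ FC := ⟨h₀, 𝟙 X'D, wh⟩
  have hh₀ : PreFrobenioid.IsIsometry C0.toElem h₀ := by
    rw [A0.isIsometry_iff_norm_mul_tip_pow]
    change ‖((1 : ℂˣ) : ℂ)‖ * X'₀.tip ^ ((1 : ℕ+) : ℕ) = X'₀.tip
    rw [Units.val_one, norm_one, one_mul, PNat.one_coe, pow_one]
  have hhA : PreFrobenioid.isometricMorphisms (C.toElem π) hC := by
    change pull _ _ (PreFrobenioid.Div C0.toElem h₀) = 1
    rw [show PreFrobenioid.Div C0.toElem h₀ = 1 from hh₀, map_one]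
  let hA : (⟨⟨X'₀, X'D, ιX'⟩⟩ : A π) ⟶ ⟨FC⟩ := ⟨hC, hhA⟩
  have hlin : PreFrobenioid.linearMorphisms (A.toElem π) hA := by
    change C0.degFr h₀ = 1; rfl
  let hN : (⟨⟨⟨X'₀, X'D, ιX'⟩⟩⟩ : N π) ⟶ ⟨⟨FC⟩⟩ := ⟨hA, hlin⟩
  -- `h` is an isotropic hull in `N`
  have hHull : PreFrobenioid.IsIsotropicHull (N.toC π ⋙ C.toElem π) hN := by
    refine ⟨hhA, ⟨rfl, ?_⟩, N.isIsotropic_of_isNaivelyIsotropic π ⟨⟨FC⟩⟩ hF₀, ?_⟩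
    · change IsIso (𝟙 X'D); infer_instance
    · intro W γ hW
      have hWn : W.obj.obj.fst.IsNaivelyIsotropic := N.isNaivelyIsotropic_of_isIsotropic π W hW
      obtain ⟨⟨⟨W₀, WD, ιW⟩⟩⟩ := W
      obtain ⟨⟨⟨γ₀, γD, wγ⟩, hγiso⟩, hγlin⟩ := γ
      change W₀.IsNaivelyIsotropic at hWn
      have hγ₀ : PreFrobenioid.IsIsometry C0.toElem γ₀ := hγiso
      have hγeq := (A0.isIsometry_iff_norm_mul_tip_pow γ₀).mp hγ₀
      have hmγ' : γ₀.scalar • F₀.region.carrier ^ (γ₀.degFr : ℕ) ⊆ C0.pullRegion W₀ γ₀.base := by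
        obtain ⟨PW, hPWc, hPWt, -, hPWi⟩ := exists_pulledRegion W₀ (C0.Base γ₀)
        obtain ⟨n, hn⟩ : ∃ n : ℕ, (C0.degFr γ₀ : ℕ) = n + 1 := ⟨_, (PNat.natPred_add_one _).symm⟩
        change C0.scalar γ₀ • F₀.region.carrier ^ (C0.degFr γ₀ : ℕ) ⊆ C0.pullRegion W₀ (C0.Base γ₀)
        rw [← hPWc, hn, F₀.region.smul_carrier_pow_subset_iff PW (C0.scalar γ₀) n,
          show PW.dir = univ from hPWi hWn]
        refine ⟨subset_univ _, ?_⟩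
        rw [AngularRegion.absHom_mul_pow_le_iff, hPWt, ← hn]
        exact hγeq.le
      let γ'₀ : F₀ ⟶ W₀ := ⟨γ₀.base, γ₀.degFr, γ₀.scalar, γ₀.scalar_mem, hmγ'⟩
      have wγ' : (PreFrobenioid.baseFunctor C0.toElem).map γ'₀ ≫ ιW.hom = FC.iso.hom ≫ π.map γD := wγ
      let γ'C : FC ⟶ ⟨W₀, WD, ιW⟩ := ⟨γ'₀, γD, wγ'⟩
      have hγ'₀ : PreFrobenioid.IsIsometry C0.toElem γ'₀ := by
        rw [A0.isIsometry_iff_norm_mul_tip_pow]; exact hγeq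
      have hγ'A : PreFrobenioid.isometricMorphisms (C.toElem π) γ'C := by
        change pull _ _ (PreFrobenioid.Div C0.toElem γ'₀) = 1
        rw [show PreFrobenioid.Div C0.toElem γ'₀ = 1 from hγ'₀, map_one]
      let γ'A : (⟨FC⟩ : A π) ⟶ ⟨⟨W₀, WD, ιW⟩⟩ := ⟨γ'C, hγ'A⟩
      have hγ'lin : PreFrobenioid.linearMorphisms (A.toElem π) γ'A := hγlin
      have hfacγ : h₀ ≫ γ'₀ = γ₀ := by
        refine C0.hom_ext ?_ ?_ ?_
        · change 𝟙 _ ≫ γ₀.base = γ₀.base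
          exact Category.id_comp _
        · change (1 : ℕ+) * γ₀.degFr = γ₀.degFr
          exact one_mul _
        · change D0.Hom.act (𝟙 X'₀.base) γ₀.scalar * 1 ^ (γ₀.degFr : ℕ) = γ₀.scalar
          rw [one_pow, mul_one]
          change D0.galAct (D0.Hom.twists (𝟙 X'₀.base)) γ₀.scalar = γ₀.scalar
          rw [D0.twists_id, D0.galAct_false]
      refine ⟨⟨γ'A, hγ'lin⟩, ?_, ?_⟩
      · exact WideSubcategory.hom_ext _
          (WideSubcategory.hom_ext _ (CFP.hom_ext hfacγ (Category.id_comp _)))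
      · rintro ⟨⟨⟨γ''₀, γ''D, wγ''⟩, hγ''iso⟩, hγ''lin⟩ hcomp
        have h1 : h₀ ≫ γ''₀ = γ₀ := congrArg (fun k => k.hom.hom.fst) hcomp
        have h2 : 𝟙 X'D ≫ γ''D = γD := congrArg (fun k => k.hom.hom.snd) hcomp
        rw [Category.id_comp] at h2
        subst h2
        have h3 : γ''₀ = γ'₀ := by
          have hb : 𝟙 _ ≫ γ''₀.base = γ₀.base := congrArg C0.Hom.base h1
          have hd : (1 : ℕ+) * γ''₀.degFr = γ₀.degFr := congrArg C0.Hom.degFr h1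
          have hs : D0.Hom.act (𝟙 X'₀.base) γ''₀.scalar * 1 ^ (γ''₀.degFr : ℕ) = γ₀.scalar :=
            congrArg C0.Hom.scalar h1
          rw [Category.id_comp] at hb
          rw [one_mul] at hd
          rw [one_pow, mul_one] at hs
          change D0.galAct (D0.Hom.twists (𝟙 X'₀.base)) γ''₀.scalar = γ₀.scalar at hs
          rw [D0.twists_id, D0.galAct_false] at hs
          exact C0.hom_ext hb hd hs
        subst h3
        rfl
  rcases hh ⟨⟨FC⟩⟩ hN hHull with hi | hslit
  · haveI : IsIso hN.hom.hom := by
      haveI := hi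
      exact (inferInstance : IsIso ((N.toC π).map hN))
    haveI : IsIso h₀ := CFP.isIso_fst hN.hom.hom
    refine ⟨1, fun w _ => ?_⟩
    have hmem : ((w : ↥(normOneSubgroup ℂ)) : ℂˣ) * ofPosReal ℂ X'₀.region.tip ∈ F₀.region.carrier := by
      rw [C0.mem_carrier_of_isIsotropic hF₀, map_mul, absHom_coe_normOne, one_mul, absHom_ofPosReal]
      exact le_rfl
    have h := C0.act_mem_carrier_of_isIso h₀ rfl rfl hmem
    change D0.galAct (D0.Hom.twists (𝟙 X'₀.base)) _ ∈ _ at h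
    rw [D0.twists_id, D0.galAct_false, AngularRegion.coe_mul_ofPosReal_mem_carrier_iff] at h
    exact h.1
  · obtain ⟨z, hz⟩ := hslit.2
    change X'₀.region.dir = {z}ᶜ at hz
    exact ⟨z, fun w hw => by change w ∈ X'₀.region.dir; rw [hz]; exact hw⟩

/-- **Steps 1–3 for `N`**: under condition (b), a translate of the `deg_Fr(φ)`-fold product of the
angular part of `X` misses at most one point of `S¹`. [cite: MochizukiFrdII2008, Prop 3.4 (ii) p.30] -/
theorem N.compl_subset_of_condB {X Y : N π} (φ : X ⟶ Y) (hb : (towerN π).CondB φ) :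
    ∃ (e q : ↥(normOneSubgroup ℂ)),
      ({q}ᶜ : Set ↥(normOneSubgroup ℂ)) ⊆
        e • X.obj.obj.fst.region.dir ^ (C0.degFr φ.hom.hom.fst : ℕ) := by
  obtain ⟨X', β, α, hfac, hFT, hlin, hhull⟩ := hb
  have hlin' : C0.degFr α.hom.hom.fst = 1 := hlin
  have hdeg : C0.degFr φ.hom.hom.fst = C0.degFr β.hom.hom.fst := by
    rw [← hfac]
    change C0.degFr (β.hom.hom.fst ≫ α.hom.hom.fst) = _
    rw [C0.degFr_comp', hlin', mul_one]
  obtain ⟨z, hz⟩ := N.compl_subset_dir_of_hulls π X' hhull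
  obtain ⟨q, hq⟩ := C0.compl_subset_of_act_mem β.hom.hom.fst
    (N.act_mem_product_of_isFrobeniusType π β hFT) hz
  exact ⟨unitPart ℂ (C0.scalar β.hom.hom.fst), q, by rw [hdeg]; exact hq⟩

/-! ### Proposition 3.4 (ii) for `F = N` -/

/-- **Proposition 3.4 (ii) for the non-rigidified angloid `N`**, both conditions, AS TYPED.
[cite: MochizukiFrdII2008, Prop 3.4 (ii) p.30] -/
theorem N.propII : (towerN π).PropII := by
  intro X Y φ hφ hcond
  haveI := hφ
  refine ⟨fun {Zd} a b h => ?_⟩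
  change a ≫ φ.hom.hom.snd = b ≫ φ.hom.hom.snd at h
  by_cases hab : π.map a = π.map b
  · obtain ⟨Z', a', b', hfst, hab', hcomp, hdeg, hdiv⟩ := C.exists_lift₂ π X.obj.obj a b hab
    have hdiv' : PreFrobenioid.Div C0.toElem a'.fst = 1 := hdiv
    have ha' : PreFrobenioid.isometricMorphisms (C.toElem π) a' := by
      change pull _ _ (PreFrobenioid.Div C0.toElem a'.fst) = 1
      rw [hdiv', map_one]
    have hb' : PreFrobenioid.isometricMorphisms (C.toElem π) b' := by
      change pull _ _ (PreFrobenioid.Div C0.toElem b'.fst) = 1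
      rw [← hfst, hdiv', map_one]
    have hla : PreFrobenioid.linearMorphisms (A.toElem π) (⟨a', ha'⟩ : (⟨Z'⟩ : A π) ⟶ X.obj) := hdeg
    have hlb : PreFrobenioid.linearMorphisms (A.toElem π) (⟨b', hb'⟩ : (⟨Z'⟩ : A π) ⟶ X.obj) := by
      change C0.degFr b'.fst = 1
      rw [← hfst]
      exact hdeg
    have heq : (⟨⟨a', ha'⟩, hla⟩ : (⟨⟨Z'⟩⟩ : N π) ⟶ X) ≫ φ =
        (⟨⟨b', hb'⟩, hlb⟩ : (⟨⟨Z'⟩⟩ : N π) ⟶ X) ≫ φ :=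
      WideSubcategory.hom_ext _ (WideSubcategory.hom_ext _ (hcomp φ.hom.hom h))
    exact hab' (congrArg (fun f => InducedWideCategory.Hom.hom (InducedWideCategory.Hom.hom f))
      ((cancel_mono φ).mp heq))
  · have hb : (towerN π).CondB φ := by
      refine hcond.resolve_left fun ha => hab ?_
      exact map_eq_of_isIso_map π a b _ ha h
    obtain ⟨e, q, hbig⟩ := N.compl_subset_of_condB π φ hb
    obtain ⟨hZc, hXc⟩ := D0.eq_complex_of_ne hab
    have hYr : π.obj Y.obj.obj.snd = D0.real :=
      D0.eq_real_of_comp_eq hab (π.map φ.hom.hom.snd)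
        (by rw [← Functor.map_comp, h, Functor.map_comp])
    obtain ⟨⟨⟨⟨KX, RX, hRX⟩, XD, ιX⟩⟩⟩ := X
    obtain ⟨⟨⟨⟨KY, RY, hRY⟩, YD, ιY⟩⟩⟩ := Y
    obtain ⟨⟨⟨φ₀, φD, wφ⟩, hφiso⟩, hφlin⟩ := φ
    change XD ⟶ YD at φD
    change Zd ⟶ XD at a b
    change a ≫ φD = b ≫ φD at h
    change π.obj XD = D0.complex at hXc
    change π.obj YD = D0.real at hYr
    have hKX : KX = D0.complex := by
      haveI : IsIso ιX.hom := ιX.isIso_hom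
      exact (D0.eq_of_isIso ιX.hom).trans hXc
    have hKY : KY = D0.real := by
      haveI : IsIso ιY.hom := ιY.isIso_hom
      exact (D0.eq_of_isIso ιY.hom).trans hYr
    subst hKX
    subst hKY
    change ({q}ᶜ : Set ↥(normOneSubgroup ℂ)) ⊆ e • RX.dir ^ (C0.degFr φ₀ : ℕ) at hbig
    obtain ⟨RZ, hRZ, a₀, b₀, ha₀b, hb₀b, ha₀d, hb₀d, ha₀i, hb₀i, hcomp₀⟩ :=
      C0.exists_conj_pair_of_compl_subset RX hRX RY hRY φ₀ hbig
    haveI : IsIso (π.map a) := D0.isIso_of_eq_complex _ hXc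
    let ea : π.obj Zd ≅ π.obj XD := asIso (π.map a)
    let ιZ : (PreFrobenioid.baseFunctor C0.toElem).obj (C0.mk D0.complex RZ hRZ) ≅ π.obj Zd :=
      ιX ≪≫ ea.symm
    have wa : (PreFrobenioid.baseFunctor C0.toElem).map a₀ ≫ ιX.hom = ιZ.hom ≫ π.map a := by
      rw [show (PreFrobenioid.baseFunctor C0.toElem).map a₀ = C0.Base a₀ from rfl, ha₀b]
      change 𝟙 _ ≫ ιX.hom = (ιX.hom ≫ ea.inv) ≫ ea.hom
      rw [Category.assoc, ea.inv_hom_id, Category.comp_id]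
      exact Category.id_comp _
    have wb : (PreFrobenioid.baseFunctor C0.toElem).map b₀ ≫ ιX.hom = ιZ.hom ≫ π.map b := by
      rw [show (PreFrobenioid.baseFunctor C0.toElem).map b₀ = C0.Base b₀ from rfl, hb₀b]
      change D0.conj ≫ ιX.hom = (ιX.hom ≫ ea.inv) ≫ π.map b
      have h1 : D0.conj ≫ ιX.hom ≠ ιX.hom := by
        intro hc
        apply D0.conj_ne_id
        exact (cancel_mono ιX.hom).mp (hc.trans (Category.id_comp ιX.hom).symm)
      have h2 : (ιX.hom ≫ ea.inv) ≫ π.map b ≠ ιX.hom := by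
        intro hc
        apply hab
        rw [Category.assoc] at hc
        have h' : ea.inv ≫ π.map b = 𝟙 _ :=
          (cancel_epi ιX.hom).mp (hc.trans (Category.comp_id ιX.hom).symm)
        have h'' := (Iso.inv_comp_eq ea).mp h'
        rw [Category.comp_id] at h''
        exact h''.symm
      exact D0.hom_eq_of_ne_of_ne h1 h2
    let ZC : C π := ⟨C0.mk D0.complex RZ hRZ, Zd, ιZ⟩
    let XC : C π := ⟨C0.mk D0.complex RX hRX, XD, ιX⟩
    let aC : ZC ⟶ XC := ⟨a₀, a, wa⟩
    let bC : ZC ⟶ XC := ⟨b₀, b, wb⟩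
    have haA : PreFrobenioid.isometricMorphisms (C.toElem π) aC := by
      change pull _ _ (PreFrobenioid.Div C0.toElem a₀) = 1
      rw [show PreFrobenioid.Div C0.toElem a₀ = 1 from ha₀i, map_one]
    have hbA : PreFrobenioid.isometricMorphisms (C.toElem π) bC := by
      change pull _ _ (PreFrobenioid.Div C0.toElem b₀) = 1
      rw [show PreFrobenioid.Div C0.toElem b₀ = 1 from hb₀i, map_one]
    let aA : (⟨ZC⟩ : A π) ⟶ ⟨XC⟩ := ⟨aC, haA⟩
    let bA : (⟨ZC⟩ : A π) ⟶ ⟨XC⟩ := ⟨bC, hbA⟩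
    have hal : PreFrobenioid.linearMorphisms (A.toElem π) aA := ha₀d
    have hbl : PreFrobenioid.linearMorphisms (A.toElem π) bA := hb₀d
    let aN : (⟨⟨ZC⟩⟩ : N π) ⟶ ⟨⟨XC⟩⟩ := ⟨aA, hal⟩
    let bN : (⟨⟨ZC⟩⟩ : N π) ⟶ ⟨⟨XC⟩⟩ := ⟨bA, hbl⟩
    have heq : aN ≫ ⟨⟨⟨φ₀, φD, wφ⟩, hφiso⟩, hφlin⟩ = bN ≫ ⟨⟨⟨φ₀, φD, wφ⟩, hφiso⟩, hφlin⟩ :=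
      WideSubcategory.hom_ext _ (WideSubcategory.hom_ext _ (CFP.hom_ext hcomp₀ h))
    exact congrArg (fun k => k.hom.hom.snd) (hφ.right_cancellation _ _ heq)

end ArchFrd

end

end Literature.AlgebraicGeometry.Frobenioids
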